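import Summits.QuantumFields.YangMills.Theses.SqueezedSkewness

/-!
# `SqueezedSkewness.DivisibleBump` — proved (support item `stmt-QuantumFields-28193`)

Route `SqueezedSkewness` (planner ym-idea-6 g7, LINE A «vacuum domination»; the item is also wanted
by `ThermalDescent`).  The item asks, for every radius `ρ > 0`, for a non-negative Schwartz bump `v`
supported in `closedBall(e₀, ρ)` and inside a slab `{δ₁ < y₀ < δ₂}` with `δ₁ > 0`, and a
non-negative, non-zero Schwartz bump `f` supported in `closedBall(2e₀, ½)`, whose lattice
Laplace–Fourier sums dominate: `c‖LF_s f(E,p)‖ ≤ ‖LF_s v(E,p)‖` for `0 < s ≤ s₀`, `E ≥ 0`, `p ∈ ℝ³`.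

WITNESS (simpler than the line card's wide product bump — the typed statement does not ask `f` to be
wide, and `HighBallFloors` quantifies over every non-negative non-zero bump in that ball, so the
route's `closes` is unaffected).  With `r = min ρ ¼ / 8`, one spatial profile
`G(y) = ψ(y₁) ψ(y₂) ψ(y₃)` (`ψ` a `ContDiffBump` at `0`, outer radius `r`) is SHARED by both bumps,
and the time profiles are `φ₁` (a `ContDiffBump` at `1`, plateau radius `2r`, outer radius `3r`)
and `φ₂` (at `2`, outer radius `r`):  `v(y) = φ₁(y₀)·G(y)`, `f(y) = φ₂(y₀)·G(y)`.
For `s > 0` the lattice sums are finitely supported and FACTORISE over `ℤ⁴ = ℤ × ℤ³` into the real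
non-negative time factor `T_φ(s,E) = Σ_t φ(st) e^{−Est}` times a COMMON complex spatial factor; and
`T_{φ₂} ≤ T_{φ₁}` for `s ≤ r`, `E ≥ 0` by the index shift `t ↦ t − ⌊1/s⌋`: whenever `φ₂(st) ≠ 0`
one has `|st − 2| < r`, hence `|s(t − ⌊1/s⌋) − 1| < r + s ≤ 2r` (so `φ₁ = 1` there) and
`e^{−Est} ≤ e^{−Es(t−⌊1/s⌋)}`.  Hence `c = 1`, `s₀ = r`; no Poisson summation is needed.

HONEST SCOPE.  Routine analysis support of a LINE onto the rung leaf `BalabanLadder.NT` (R2a); the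
line's cruxes (`HighBallFloors`, `VacuumDomination`, …), the rung and every summit statement stay
open; nothing here bears on the Yang–Mills mass gap.  No definitions, no named facts. [folklore]
-/

noncomputable section

open scoped BigOperators ContDiff
open MeasureTheory Filter Topology Set Metric
open Literature.MathematicalPhysics.QuantumLattice

namespace Summit.QuantumFields.YangMills.Theorems.SqueezedSkewnessDivisibleBump

/-! ### 1. Lattice samples of a bump are finitely supported -/

/-- The integers `t` with `|s t − c| < R` form a finite set when `s > 0`. [folklore] -/
theorem finite_int_window {s : ℝ} (hs : 0 < s) (c R : ℝ) :
    Set.Finite {t : ℤ | |s * (t : ℝ) - c| < R} := by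
  refine (Set.finite_Icc ⌊(c - R) / s⌋ ⌈(c + R) / s⌉).subset ?_
  intro t ht
  simp only [Set.mem_setOf_eq, abs_lt] at ht
  obtain ⟨h1, h2⟩ := ht
  refine ⟨?_, ?_⟩
  · have h : ((c - R) / s : ℝ) < t := by rw [div_lt_iff₀ hs]; linarith
    have h' : ((⌊(c - R) / s⌋ : ℤ) : ℝ) < t := (Int.floor_le _).trans_lt h
    exact (by exact_mod_cast h' : ⌊(c - R) / s⌋ < t).le
  · have h : (t : ℝ) < (c + R) / s := by rw [lt_div_iff₀ hs]; linarith
    have h' : (t : ℝ) < ((⌈(c + R) / s⌉ : ℤ) : ℝ) := h.trans_le (Int.le_ceil _)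
    exact (by exact_mod_cast h' : t < ⌈(c + R) / s⌉).le

/-- A function of `t : ℤ` vanishing wherever the sample `φ(s t)` of a bump does has finite support
(`s > 0`). [folklore] -/
theorem hasFiniteSupport_of_bump {c : ℝ} (φ : ContDiffBump c) {s : ℝ} (hs : 0 < s) {α : Type*}
    [Zero α] (a : ℤ → α) (ha : ∀ t : ℤ, φ (s * t) = 0 → a t = 0) : Function.HasFiniteSupport a := by
  refine (finite_int_window hs c φ.rOut).subset ?_
  intro t ht
  have h : φ (s * t) ≠ 0 := fun h0 => ht (ha t h0)
  have hmem : (s * (t : ℝ)) ∈ Function.support (φ : ℝ → ℝ) := h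
  rw [φ.support_eq, Metric.mem_ball, Real.dist_eq] at hmem
  exact hmem

/-- A function of `n : ℤ³` vanishing wherever one of the samples `ψ(s nₖ)` does has finite support
(`s > 0`). [folklore] -/
theorem hasFiniteSupport_of_bump3 (ψ : ContDiffBump (0 : ℝ)) {s : ℝ} (hs : 0 < s) {α : Type*}
    [Zero α] (b : (Fin 3 → ℤ) → α) (hb : ∀ n : Fin 3 → ℤ, (∃ k, ψ (s * (n k : ℝ)) = 0) → b n = 0) :
    Function.HasFiniteSupport b := by
  refine (Set.Finite.pi (fun _ : Fin 3 => finite_int_window hs 0 ψ.rOut)).subset ?_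
  intro n hn
  rw [Set.mem_univ_pi]
  intro k
  have h : ψ (s * (n k : ℝ)) ≠ 0 := fun h0 => hn (hb n ⟨k, h0⟩)
  have hmem : (s * (n k : ℝ)) ∈ Function.support (ψ : ℝ → ℝ) := h
  rw [ψ.support_eq, Metric.mem_ball, Real.dist_eq] at hmem
  exact hmem

/-! ### 2. A finitely supported product sum over `ℤ⁴ = ℤ × ℤ³` factorises -/

/-- `Σ_{x ∈ ℤ⁴} A(x₀) B(x₁,x₂,x₃) = (Σ A)(Σ B)` for finitely supported `A`, `B`. [folklore] -/
theorem tsum_fin4_mul (A : ℤ → ℂ) (B : (Fin 3 → ℤ) → ℂ) (hA : Function.HasFiniteSupport A)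
    (hB : Function.HasFiniteSupport B) :
    ∑' x : Fin 4 → ℤ, A (x 0) * B (fun k => x k.succ) = (∑' t : ℤ, A t) * ∑' n : Fin 3 → ℤ, B n := by
  have hAB : Summable fun z : ℤ × (Fin 3 → ℤ) => A z.1 * B z.2 := by
    refine summable_of_hasFiniteSupport ((hA.prod hB).subset ?_)
    intro z hz
    simp only [Function.mem_support, ne_eq, mul_eq_zero, not_or] at hz
    exact ⟨hz.1, hz.2⟩
  calc ∑' x : Fin 4 → ℤ, A (x 0) * B (fun k => x k.succ)
      = ∑' z : ℤ × (Fin 3 → ℤ), A ((Fin.consEquiv (fun _ => ℤ) z) 0)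
          * B (fun k => (Fin.consEquiv (fun _ => ℤ) z) k.succ) :=
        (Equiv.tsum_eq (Fin.consEquiv fun _ : Fin 4 => ℤ)
          (fun x : Fin 4 → ℤ => A (x 0) * B (fun k => x k.succ))).symm
    _ = ∑' z : ℤ × (Fin 3 → ℤ), A z.1 * B z.2 := by
        refine tsum_congr fun z => ?_
        simp only [Fin.consEquiv_apply, Fin.cons_zero, Fin.cons_succ]
    _ = (∑' t : ℤ, A t) * ∑' n : Fin 3 → ℤ, B n :=
        ((summable_of_hasFiniteSupport hA).tsum_mul_tsum (summable_of_hasFiniteSupport hB) hAB).symm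

/-! ### 3. Product bumps `y ↦ φ(y₀) ψ(y₁) ψ(y₂) ψ(y₃)` -/

/-- Smoothness of the product profile. [folklore] -/
theorem contDiff_prodProfile {c : ℝ} (φ : ContDiffBump c) (ψ : ContDiffBump (0 : ℝ)) :
    ContDiff ℝ ∞ (fun y : EuclideanSpace ℝ (Fin 4) => φ (y 0) * (ψ (y 1) * ψ (y 2) * ψ (y 3))) := by
  have hc : ∀ i : Fin 4, ContDiff ℝ ∞ (fun y : EuclideanSpace ℝ (Fin 4) => y i) :=
    fun i => contDiff_piLp_apply (𝕜 := ℝ) (E := fun _ : Fin 4 => ℝ) 2 (i := i)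
  exact (φ.contDiff.comp (hc 0)).mul
    (((ψ.contDiff.comp (hc 1)).mul (ψ.contDiff.comp (hc 2))).mul (ψ.contDiff.comp (hc 3)))

/-- Where the product profile is non-zero, every coordinate is within the outer radii. [folklore] -/
theorem coords_of_ne_zero {c : ℝ} (φ : ContDiffBump c) (ψ : ContDiffBump (0 : ℝ))
    {y : EuclideanSpace ℝ (Fin 4)} (h : φ (y 0) * (ψ (y 1) * ψ (y 2) * ψ (y 3)) ≠ 0) :
    |y 0 - c| < φ.rOut ∧ |y 1| < ψ.rOut ∧ |y 2| < ψ.rOut ∧ |y 3| < ψ.rOut := by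
  have key : ∀ {c' : ℝ} (χ : ContDiffBump c') {u : ℝ}, χ u ≠ 0 → |u - c'| < χ.rOut := by
    intro c' χ u hu
    have hmem : u ∈ Function.support (χ : ℝ → ℝ) := hu
    rwa [χ.support_eq, Metric.mem_ball, Real.dist_eq] at hmem
  simp only [ne_eq, mul_eq_zero, not_or] at h
  obtain ⟨h0, ⟨h1, h2⟩, h3⟩ := h
  exact ⟨key φ h0, by simpa using key ψ h1, by simpa using key ψ h2, by simpa using key ψ h3⟩

/-- The product profile vanishes outside the closed ball of radius `φ.rOut + 3ψ.rOut` around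
`c e₀`. [folklore] -/
theorem dist_le_of_ne_zero {c : ℝ} (φ : ContDiffBump c) (ψ : ContDiffBump (0 : ℝ))
    {y : EuclideanSpace ℝ (Fin 4)} (h : φ (y 0) * (ψ (y 1) * ψ (y 2) * ψ (y 3)) ≠ 0) :
    dist y (EuclideanSpace.single (0 : Fin 4) c) ≤ φ.rOut + 3 * ψ.rOut := by
  obtain ⟨h0, h1, h2, h3⟩ := coords_of_ne_zero φ ψ h
  have hR0 := φ.rOut_pos
  have hR1 := ψ.rOut_pos
  rw [EuclideanSpace.dist_eq]
  have hsum : ∑ i : Fin 4, dist (y i) ((EuclideanSpace.single (0 : Fin 4) c) i) ^ 2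
      = |y 0 - c| ^ 2 + |y 1| ^ 2 + |y 2| ^ 2 + |y 3| ^ 2 := by
    simp [Fin.sum_univ_four, Real.dist_eq, PiLp.single_apply]
  rw [hsum]
  calc Real.sqrt (|y 0 - c| ^ 2 + |y 1| ^ 2 + |y 2| ^ 2 + |y 3| ^ 2)
      ≤ Real.sqrt ((φ.rOut + 3 * ψ.rOut) ^ 2) :=
        Real.sqrt_le_sqrt (by
          nlinarith [abs_nonneg (y 0 - c), abs_nonneg (y 1), abs_nonneg (y 2), abs_nonneg (y 3)])
    _ = φ.rOut + 3 * ψ.rOut := Real.sqrt_sq (by positivity)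

/-- Compact support of the product profile. [folklore] -/
theorem hasCompactSupport_prodProfile {c : ℝ} (φ : ContDiffBump c) (ψ : ContDiffBump (0 : ℝ)) :
    HasCompactSupport
      (fun y : EuclideanSpace ℝ (Fin 4) => φ (y 0) * (ψ (y 1) * ψ (y 2) * ψ (y 3))) :=
  HasCompactSupport.of_support_subset_isCompact
    (isCompact_closedBall (EuclideanSpace.single (0 : Fin 4) c) (φ.rOut + 3 * ψ.rOut))
    (fun _ hy => Metric.mem_closedBall.mpr (dist_le_of_ne_zero φ ψ hy))

/-- The (topological) support of the product profile lies in that closed ball. [folklore] -/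
theorem tsupport_prodProfile_subset {c : ℝ} (φ : ContDiffBump c) (ψ : ContDiffBump (0 : ℝ)) :
    tsupport (fun y : EuclideanSpace ℝ (Fin 4) => φ (y 0) * (ψ (y 1) * ψ (y 2) * ψ (y 3)))
      ⊆ Metric.closedBall (EuclideanSpace.single (0 : Fin 4) c) (φ.rOut + 3 * ψ.rOut) :=
  closure_minimal (fun _ hy => Metric.mem_closedBall.mpr (dist_le_of_ne_zero φ ψ hy))
    Metric.isClosed_closedBall

/-! ### 4. The lattice Laplace–Fourier sum of a product bump factorises -/

/-- `LF_s F(E,p) = T_φ(s,E) · S_ψ(s,p)` for a product bump `F(y) = φ(y₀)ψ(y₁)ψ(y₂)ψ(y₃)`: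
a real time factor times a spatial factor that does not depend on `φ`. [folklore] -/
theorem LF_eq {c : ℝ} (φ : ContDiffBump c) (ψ : ContDiffBump (0 : ℝ))
    (F : EuclideanSpace ℝ (Fin 4) → ℝ) (hF : ∀ y, F y = φ (y 0) * (ψ (y 1) * ψ (y 2) * ψ (y 3)))
    {s : ℝ} (hs : 0 < s) (E : ℝ) (p : Fin 3 → ℝ) :
    ∑' x : Fin 4 → ℤ, (((F (s • siteToE (d := 4) x) * Real.exp (-(E * (s * (x 0 : ℝ))))) : ℝ) : ℂ)
        * Complex.exp (Complex.I * ((s * ∑ k : Fin 3, p k * (x k.succ : ℝ) : ℝ) : ℂ))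
      = ((∑' t : ℤ, φ (s * t) * Real.exp (-(E * (s * t))) : ℝ) : ℂ)
        * ∑' n : Fin 3 → ℤ, (((ψ (s * n 0) * ψ (s * n 1) * ψ (s * n 2)) : ℝ) : ℂ)
            * Complex.exp (Complex.I * ((s * ∑ k : Fin 3, p k * (n k : ℝ) : ℝ) : ℂ)) := by
  have hcoord : ∀ (x : Fin 4 → ℤ) (i : Fin 4), (s • siteToE (d := 4) x) i = s * (x i : ℝ) := by
    intro x i
    simp [siteToE_apply]
  have e3 : (2 : Fin 3).succ = (3 : Fin 4) := rfl
  have hterm : ∀ x : Fin 4 → ℤ,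
      (((F (s • siteToE (d := 4) x) * Real.exp (-(E * (s * (x 0 : ℝ))))) : ℝ) : ℂ)
        * Complex.exp (Complex.I * ((s * ∑ k : Fin 3, p k * (x k.succ : ℝ) : ℝ) : ℂ))
      = (fun t : ℤ => (((φ (s * t) * Real.exp (-(E * (s * t)))) : ℝ) : ℂ)) (x 0)
        * (fun n : Fin 3 → ℤ => (((ψ (s * n 0) * ψ (s * n 1) * ψ (s * n 2)) : ℝ) : ℂ)
            * Complex.exp (Complex.I * ((s * ∑ k : Fin 3, p k * (n k : ℝ) : ℝ) : ℂ)))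
          (fun k => x k.succ) := by
    intro x
    rw [hF, hcoord, hcoord, hcoord, hcoord]
    simp only [Fin.succ_zero_eq_one, Fin.succ_one_eq_two, e3]
    push_cast
    ring
  have hAfin : Function.HasFiniteSupport
      (fun t : ℤ => (((φ (s * t) * Real.exp (-(E * (s * t)))) : ℝ) : ℂ)) :=
    hasFiniteSupport_of_bump φ hs _ (fun t h0 => by simp [h0])
  have hBfin : Function.HasFiniteSupport
      (fun n : Fin 3 → ℤ => (((ψ (s * n 0) * ψ (s * n 1) * ψ (s * n 2)) : ℝ) : ℂ)
        * Complex.exp (Complex.I * ((s * ∑ k : Fin 3, p k * (n k : ℝ) : ℝ) : ℂ))) := by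
    refine hasFiniteSupport_of_bump3 ψ hs _ (fun n hn => ?_)
    obtain ⟨k, hk⟩ := hn
    have hprod : ψ (s * (n 0 : ℝ)) * ψ (s * (n 1 : ℝ)) * ψ (s * (n 2 : ℝ)) = 0 := by
      fin_cases k
      · exact mul_eq_zero_of_left (mul_eq_zero_of_left hk _) _
      · exact mul_eq_zero_of_left (mul_eq_zero_of_right _ hk) _
      · exact mul_eq_zero_of_right _ hk
    simp [hprod]
  rw [tsum_congr hterm, tsum_fin4_mul _ _ hAfin hBfin, Complex.ofReal_tsum]

/-- The time factor is non-negative. [folklore] -/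
theorem time_tsum_nonneg {c : ℝ} (φ : ContDiffBump c) (s E : ℝ) :
    0 ≤ ∑' t : ℤ, φ (s * t) * Real.exp (-(E * (s * t))) :=
  tsum_nonneg fun _ => mul_nonneg φ.nonneg (Real.exp_pos _).le

/-! ### 5. Comparison of the time factors by an index shift -/

/-- `T_{φ₂}(s,E) ≤ T_{φ₁}(s,E)` for `0 < s ≤ r`, `E ≥ 0`, when `φ₁` (around `1`) has plateau radius
`2r` and `φ₂` (around `2`) has outer radius `r`: shift the summation index by `⌊1/s⌋`. [folklore] -/
theorem time_tsum_le (φ₁ : ContDiffBump (1 : ℝ)) (φ₂ : ContDiffBump (2 : ℝ)) {r s E : ℝ}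
    (h1 : φ₁.rIn = 2 * r) (h2 : φ₂.rOut = r) (hs : 0 < s) (hsr : s ≤ r) (hE : 0 ≤ E) :
    ∑' t : ℤ, φ₂ (s * t) * Real.exp (-(E * (s * t)))
      ≤ ∑' t : ℤ, φ₁ (s * t) * Real.exp (-(E * (s * t))) := by
  set m : ℤ := ⌊s⁻¹⌋ with hm
  have hm0 : (0 : ℝ) ≤ m := by exact_mod_cast Int.floor_nonneg.mpr (inv_nonneg.mpr hs.le)
  have hsm1 : s * m ≤ 1 := by
    calc s * m ≤ s * s⁻¹ := mul_le_mul_of_nonneg_left (Int.floor_le _) hs.le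
      _ = 1 := mul_inv_cancel₀ hs.ne'
  have hsm2 : 1 - s < s * m := by
    have h := mul_lt_mul_of_pos_left (Int.lt_floor_add_one s⁻¹) hs
    rw [mul_inv_cancel₀ hs.ne'] at h
    linarith
  have hreindex : ∑' t : ℤ, φ₁ (s * t) * Real.exp (-(E * (s * t)))
      = ∑' t : ℤ, φ₁ (s * ((t - m : ℤ) : ℝ)) * Real.exp (-(E * (s * ((t - m : ℤ) : ℝ)))) :=
    (Equiv.tsum_eq (Equiv.subRight m) (fun t : ℤ => φ₁ (s * t) * Real.exp (-(E * (s * t))))).symm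
  rw [hreindex]
  refine Summable.tsum_le_tsum (fun t => ?_) ?_ ?_
  · by_cases h0 : φ₂ (s * t) = 0
    · rw [h0, zero_mul]
      exact mul_nonneg φ₁.nonneg (Real.exp_pos _).le
    · have hlt : |s * t - 2| < r := by
        have hmem : (s * (t : ℝ)) ∈ Function.support (φ₂ : ℝ → ℝ) := h0
        rw [φ₂.support_eq, Metric.mem_ball, Real.dist_eq, h2] at hmem
        exact hmem
      obtain ⟨hlt1, hlt2⟩ := abs_lt.mp hlt
      have hone : φ₁ (s * ((t - m : ℤ) : ℝ)) = 1 := by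
        apply φ₁.one_of_mem_closedBall
        rw [Metric.mem_closedBall, Real.dist_eq, h1]
        push_cast
        rw [abs_le]
        constructor <;> nlinarith
      rw [hone, one_mul]
      calc φ₂ (s * t) * Real.exp (-(E * (s * t)))
          ≤ 1 * Real.exp (-(E * (s * ((t - m : ℤ) : ℝ)))) := by
            refine mul_le_mul φ₂.le_one ?_ (Real.exp_pos _).le zero_le_one
            refine Real.exp_le_exp.mpr ?_
            push_cast
            nlinarith [mul_nonneg hE (mul_nonneg hs.le hm0)]
        _ = Real.exp (-(E * (s * ((t - m : ℤ) : ℝ)))) := one_mul _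
  · exact summable_of_hasFiniteSupport
      (hasFiniteSupport_of_bump φ₂ hs _ (fun t h => by rw [h, zero_mul]))
  · refine summable_of_hasFiniteSupport ((finite_int_window hs (1 + s * m) φ₁.rOut).subset ?_)
    intro t ht
    have h' : φ₁ (s * ((t - m : ℤ) : ℝ)) * Real.exp (-(E * (s * ((t - m : ℤ) : ℝ)))) ≠ 0 := ht
    have h : φ₁ (s * ((t - m : ℤ) : ℝ)) ≠ 0 := fun h0 => h' (by rw [h0, zero_mul])
    have hmem : (s * ((t - m : ℤ) : ℝ)) ∈ Function.support (φ₁ : ℝ → ℝ) := h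
    rw [φ₁.support_eq, Metric.mem_ball, Real.dist_eq] at hmem
    simp only [Set.mem_setOf_eq]
    push_cast at hmem
    have : s * (t : ℝ) - (1 + s * m) = s * (t - m) - 1 := by ring
    rw [this]
    exact hmem

/-! ### 6. The item -/

/-- **`DivisibleBump` holds** (item `stmt-QuantumFields-28193`, by name): for every `ρ > 0` the
product bumps `v = φ₁(y₀)G(y)` (around `e₀`, radius `≤ ρ`, in the slab `1 − 8r < y₀ < 1 + 8r`) and
`f = φ₂(y₀)G(y)` (around `2e₀`, radius `≤ ½`) with a shared spatial profile `G` satisfy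
`‖LF_s f(E,p)‖ ≤ ‖LF_s v(E,p)‖` for `0 < s ≤ r`, `E ≥ 0`, all `p` (`c = 1`).  Routine support of a
line onto `BalabanLadder.NT`; no summit statement is affected. [folklore] -/
theorem divisibleBump_proof : Summit.QuantumFields.YangMills.Theses.SqueezedSkewness.DivisibleBump := by
  unfold Summit.QuantumFields.YangMills.Theses.SqueezedSkewness.DivisibleBump
  dsimp only
  intro ρ hρ
  -- radii
  set r : ℝ := min ρ (1 / 4) / 8 with hr
  have hr0 : 0 < r := by positivity
  have hrρ : 8 * r ≤ ρ := by rw [hr]; linarith [min_le_left ρ (1 / 4)]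
  have hr4 : 8 * r ≤ 1 / 4 := by rw [hr]; linarith [min_le_right ρ (1 / 4)]
  -- profiles
  let φ₁ : ContDiffBump (1 : ℝ) := ⟨2 * r, 3 * r, by positivity, by linarith⟩
  let φ₂ : ContDiffBump (2 : ℝ) := ⟨r / 2, r, by positivity, by linarith⟩
  let ψ : ContDiffBump (0 : ℝ) := ⟨r / 2, r, by positivity, by linarith⟩
  let v : SchwartzMap (EuclideanSpace ℝ (Fin 4)) ℝ :=
    (hasCompactSupport_prodProfile φ₁ ψ).toSchwartzMap (contDiff_prodProfile φ₁ ψ)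
  let f : SchwartzMap (EuclideanSpace ℝ (Fin 4)) ℝ :=
    (hasCompactSupport_prodProfile φ₂ ψ).toSchwartzMap (contDiff_prodProfile φ₂ ψ)
  have hv : ∀ y, v y = φ₁ (y 0) * (ψ (y 1) * ψ (y 2) * ψ (y 3)) := fun y => rfl
  have hf : ∀ y, f y = φ₂ (y 0) * (ψ (y 1) * ψ (y 2) * ψ (y 3)) := fun y => rfl
  have hψnn : ∀ y : EuclideanSpace ℝ (Fin 4), 0 ≤ ψ (y 1) * ψ (y 2) * ψ (y 3) :=
    fun y => mul_nonneg (mul_nonneg ψ.nonneg ψ.nonneg) ψ.nonneg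
  have hvsupp : tsupport (v : EuclideanSpace ℝ (Fin 4) → ℝ)
      ⊆ Metric.closedBall (EuclideanSpace.single (0 : Fin 4) (1 : ℝ)) (3 * r + 3 * r) :=
    tsupport_prodProfile_subset φ₁ ψ
  have hfsupp : tsupport (f : EuclideanSpace ℝ (Fin 4) → ℝ)
      ⊆ Metric.closedBall (EuclideanSpace.single (0 : Fin 4) (2 : ℝ)) (r + 3 * r) :=
    tsupport_prodProfile_subset φ₂ ψ
  refine ⟨v, f, fun y => ?_, hvsupp.trans (Metric.closedBall_subset_closedBall (by linarith)),
    ⟨1 - 8 * r, 1 + 8 * r, by linarith, fun y hy => ?_⟩, fun y => ?_, ?_,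
    hfsupp.trans (Metric.closedBall_subset_closedBall (by linarith)), 1, r, one_pos, hr0, ?_⟩
  · -- `0 ≤ v`
    rw [hv]; exact mul_nonneg φ₁.nonneg (hψnn y)
  · -- the slab
    have hd : dist y (EuclideanSpace.single (0 : Fin 4) (1 : ℝ)) ≤ 3 * r + 3 * r := hvsupp hy
    have hc : dist (y 0) ((EuclideanSpace.single (0 : Fin 4) (1 : ℝ)) 0)
        ≤ dist y (EuclideanSpace.single (0 : Fin 4) (1 : ℝ)) := PiLp.dist_apply_le _ _ 0
    have h0 : (EuclideanSpace.single (0 : Fin 4) (1 : ℝ)) 0 = 1 := by simp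
    rw [h0, Real.dist_eq] at hc
    obtain ⟨hc1, hc2⟩ := abs_le.mp (hc.trans hd)
    exact ⟨by linarith, by linarith⟩
  · -- `0 ≤ f`
    rw [hf]; exact mul_nonneg φ₂.nonneg (hψnn y)
  · -- `f ≠ 0`
    intro h0
    have hφ : φ₂ 2 = 1 := φ₂.one_of_mem_closedBall (Metric.mem_closedBall_self (by positivity))
    have hψ : ψ 0 = 1 := ψ.one_of_mem_closedBall (Metric.mem_closedBall_self (by positivity))
    have h1 : f (EuclideanSpace.single (0 : Fin 4) (2 : ℝ)) = 1 := by
      rw [hf]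
      simp [hφ, hψ]
    rw [h0] at h1
    simp at h1
  · -- domination of the lattice sums, `c = 1`
    intro s hs hsr E hE p
    rw [one_mul, LF_eq φ₂ ψ f hf hs E p, LF_eq φ₁ ψ v hv hs E p, norm_mul, norm_mul,
      Complex.norm_real, Complex.norm_real, Real.norm_of_nonneg (time_tsum_nonneg φ₂ s E),
      Real.norm_of_nonneg (time_tsum_nonneg φ₁ s E)]
    exact mul_le_mul_of_nonneg_right (time_tsum_le φ₁ φ₂ rfl rfl hs hsr hE) (norm_nonneg _)

end Summit.QuantumFields.YangMills.Theorems.SqueezedSkewnessDivisibleBump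

end
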